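import Literature.NumberTheory.GaloisRepresentations.ChebotarevRestrict
import Literature.NumberTheory.GaloisRepresentations.ArtinReciprocityCharacterFiniteProofs
import Literature.NumberTheory.GaloisRepresentations.ArtinRestriction
import Literature.NumberTheory.GaloisRepresentations.ModNCyclotomicCharacter
import Literature.NumberTheory.GaloisRepresentations.DecomposedGeneric
import HarnessLib

/-!
# Chebotarev, existence form: degree-one places with Frobenius in a prescribed coset of an open
# normal subgroup of `Γ_F`, and with `q_v ≢ 1 (mod p)`

Topic `Literature/NumberTheory/GaloisRepresentations`.  A *proofs* file: theorems only, no named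
fact (D-0026), unconditional (the analytic input is the tree's proved degree-one Chebotarev theorem
`infinite_setOf_prime_absNorm_frobenius_restrict_eq`, `ChebotarevRestrict.lean`).

The occurrence formalised here is the Chebotarev step of the proof of the Fontaine–Laffaille
automorphy lifting theorem of Allen–Calegari–Caraiani–Gee–Helm–Le Hung–Newton–Scholze–Taylor–
Thorne, *Potential automorphy over CM fields*, Ann. of Math. 197 (2023), Thm. 6.1.1 (proof,
§6.5.12; arXiv:1812.09999 p. 89):

> By the Chebotarev density theorem, we can find a place `v₀` of `E` of degree 1 over `ℚ` such
> that `ρ̄(Frob_{v₀})` is scalar and `q_{v₀} ≢ 1 mod p`, and the residue characteristic of `v₀`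
> is odd.

granted hypothesis (4) of the theorem, "there exists `σ ∈ G_F − G_{F(ζ_p)}` such that `ρ̄(σ)` is
a scalar".  In the tree's vocabulary (`absoluteGaloisGroup F`, `HeightOneSpectrum.primesAbove`,
Mathlib's `IsArithFrobAt` and `Ideal.inertia`, `absGaloisGroupAdjoinRootsOfUnity F p = Γ_{F(ζ_p)}`
of `DecomposedGeneric.lean`, `modNCyclotomicCharacter F p = χ̄_p` of `ModNCyclotomicCharacter.lean`,
`v.residueCard = q_v`):

* `infinite_setOf_prime_absNorm_frobenius_mul_inv_mem` — for an OPEN NORMAL subgroup `N ≤ Γ_F`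
  and `g ∈ Γ_F` there are infinitely many finite places `v` of `F` of prime absolute norm (degree
  one over `ℚ`) such that every inertia group `I_𝔓 ≤ Γ_F`, `𝔓 ∣ v`, is contained in `N` ("`v`
  is unramified in `F̄^N`") and some arithmetic Frobenius `Φ` at a prime `𝔓 ∣ v` of `\bar ℤ_F`
  lies in the coset `N g` — the tree's degree-one Chebotarev theorem for the finite Galois
  extension `T = F̄^N` (`fixingSubgroup_fixedField_of_isOpen`), read through
  `Φ|_T = g|_T ↔ Φ g⁻¹ ∈ N` and "inertia dies in `Gal(T/F)` at unramified `v`"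
  (`absRestrictNormalHom_eq_one_of_isUnramifiedIn`).
* `infinite_setOf_prime_absNorm_frobenius_eq_of_not_mem_adjoinRootsOfUnity` — **the ACC+ step**:
  for a homomorphism `τ : Γ_F → H` with open kernel (e.g. a residual representation `ρ̄`), a prime
  `p` and `σ ∉ Γ_{F(ζ_p)}`, there are infinitely many places `v ∤ p` of `F` of prime absolute norm
  with `q_v ≢ 1 (mod p)`, `τ(I_𝔓) = 1` for all `𝔓 ∣ v`, and an arithmetic Frobenius `Φ` above
  `v` with `τ(Φ) = τ(σ)` (so `τ(Φ)` is scalar when `τ(σ)` is).  Proof: the previous theorem for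
  `N = ker τ ∩ ker χ̄_p` and `g = σ`; then `χ̄_p(Φ) = χ̄_p(σ) ≠ 1` (`σ ∉ Γ_{F(ζ_p)} = ker χ̄_p`,
  `mem_absGaloisGroupAdjoinRootsOfUnity_iff` with `modNCyclotomicCharacter_spec`) while
  `χ̄_p(Φ) = q_v (mod p)` for `v ∤ p` (`modNCyclotomicCharacter_eq_residueCard_of_isArithFrobAt`).
  The remaining printed side conditions (`v₀ ∉ S'`, odd residue characteristic) remove finitely
  many places from an infinite set and are left to the consumer.

These serve the named fact
`Literature.NumberTheory.Automorphic.ACCGHLNSTT2023.automorphyLifting_crystalline_weightZero`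
(`Automorphic/ACCAutomorphyLiftingCrystalline.lean`), whose hypothesis (4) is literally
`∃ σ, σ ∉ absGaloisGroupAdjoinRootsOfUnity F p ∧ ∃ c, ρ̄(σ) = c • 1`.

## References

* [ACCGHLNSTT2023] P. B. Allen et al., *Potential automorphy over CM fields*, Ann. of Math. (2)
  197 (2023), 897–1113, §6.5.12 (proof of Thm. 6.1.1), "By the Chebotarev density theorem, we
  can find a place `v₀` of `E` of degree 1 over `ℚ` …" (arXiv:1812.09999, p. 89).
* [TateGCFT1967] J. Tate, *Global class field theory*, Ch. VII of Cassels–Fröhlich (1967), §2.4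
  (Tchebotarev density theorem, existence form).
* [NeukirchANT1999] J. Neukirch, *Algebraic Number Theory* (1999), Ch. I (10.3) (`χ_N(Frob) = q`),
  Ch. VII (13.4).
-/

noncomputable section

open NumberField IsDedekindDomain Field Filter Topology

open scoped Classical

namespace Literature.NumberTheory.GaloisRepresentations

section Coset

variable {F : Type} [Field F] [NumberField F]

/-- **Chebotarev, existence form with degree-one places, for a coset of an open normal subgroup
of `Γ_F`** (Tate, Cassels–Fröhlich VII §2.4, for the finite Galois extension `T = F̄^N`).  For an
open normal subgroup `N ≤ Γ_F = Gal(F̄/F)` and `g ∈ Γ_F` there are infinitely many finite places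
`v` of `F` of prime absolute norm such that `I_𝔓 ≤ N` for every prime `𝔓 ∣ v` of `\bar ℤ_F` and
some arithmetic Frobenius `Φ ∈ Γ_F` at some `𝔓 ∣ v` satisfies `Φ g⁻¹ ∈ N`.  Proof: the tree's
`infinite_setOf_prime_absNorm_frobenius_restrict_eq` for `T = F̄^N`
(`Gal(F̄/T) = N` as `N` is open, `fixingSubgroup_fixedField_of_isOpen`; `T/F` is finite Galois as
`N` is open and normal), together with `Φ|_T = g|_T ↔ Φ g⁻¹ ∈ Gal(F̄/T)` and the vanishing of
the inertia groups of `Γ_F` in `Gal(T/F)` at places unramified in `T`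
(`absRestrictNormalHom_eq_one_of_isUnramifiedIn`). [cite: TateGCFT1967, §2.4 (Tchebotarev
density theorem, existence form)] -/
theorem infinite_setOf_prime_absNorm_frobenius_mul_inv_mem (N : Subgroup (absoluteGaloisGroup F))
    [N.Normal] (hN : IsOpen (N : Set (absoluteGaloisGroup F))) (g : absoluteGaloisGroup F) :
    {v : HeightOneSpectrum (𝓞 F) | (Ideal.absNorm v.asIdeal).Prime ∧
      (∀ 𝔓 ∈ v.primesAbove, 𝔓.inertia (absoluteGaloisGroup F) ≤ N) ∧
      ∃ 𝔓 ∈ v.primesAbove, ∃ Φ : absoluteGaloisGroup F,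
        IsArithFrobAt (𝓞 F) Φ 𝔓 ∧ Φ * g⁻¹ ∈ N}.Infinite := by
  set T : IntermediateField F (AlgebraicClosure F) := IntermediateField.fixedField N with hTdef
  have hTN : T.fixingSubgroup = N := fixingSubgroup_fixedField_of_isOpen N hN
  haveI : FiniteDimensional F T := finiteDimensional_fixedField_of_isOpen N hN
  haveI : IsGalois F T := by
    rw [← InfiniteGalois.normal_iff_isGalois, hTN]
    exact ‹N.Normal›
  haveI : NumberField T := NumberField.of_module_finite F T
  -- `Φ|_T = 1 ↔ Φ ∈ N`
  have hr : ∀ (γ : absoluteGaloisGroup F) (x : T),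
      ((absRestrictNormalHom T γ x : T) : AlgebraicClosure F) = γ • (x : AlgebraicClosure F) :=
    fun γ x => AlgEquiv.restrictNormalHom_apply T _ x
  have hker : ∀ γ : absoluteGaloisGroup F, absRestrictNormalHom T γ = 1 ↔ γ ∈ N := by
    intro γ
    have key : absRestrictNormalHom T γ = 1 ↔
        γ ∈ (T.fixingSubgroup : Subgroup (absoluteGaloisGroup F)) := by
      rw [mem_fixingSubgroup_iff_forall_smul]
      constructor
      · intro h x
        rw [← hr γ x, h, AlgEquiv.one_apply]
      · intro h
        ext x
        rw [hr γ x, AlgEquiv.one_apply]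
        exact h x
    rw [key, hTN]
    exact Iff.rfl
  refine (infinite_setOf_prime_absNorm_frobenius_restrict_eq T g).mono ?_
  rintro v ⟨hprime, hunr, 𝔓, h𝔓, Φ, hΦ, heq⟩
  refine ⟨hprime, fun 𝔓' h𝔓' γ hγ => (hker γ).mp
    (absRestrictNormalHom_eq_one_of_isUnramifiedIn T hunr h𝔓' hγ), 𝔓, h𝔓, Φ, hΦ, ?_⟩
  exact (hker _).mp (by rw [map_mul, map_inv, heq, mul_inv_cancel])

/-- **The Chebotarev step of ACC+ Thm. 6.1.1: degree-one places `v ∤ p` with `τ(Frob_v) = τ(σ)`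
and `q_v ≢ 1 (mod p)`.**  Let `τ : Γ_F → H` be a homomorphism with open kernel (e.g. a residual
Galois representation `ρ̄ : Γ_F → GL_n(𝔽̄_p)`), `p` a prime and `σ ∈ Γ_F ∖ Γ_{F(ζ_p)}`.  Then there
are infinitely many finite places `v` of `F` with: `N v` prime (degree one over `ℚ`), `v ∤ p`,
`q_v ≢ 1 (mod p)`, `τ` trivial on every inertia group above `v`, and an arithmetic Frobenius
`Φ ∈ Γ_F` at a prime of `\bar ℤ_F` above `v` with `τ(Φ) = τ(σ)` — in particular `τ(Φ)` is scalar
if `τ(σ)` is ("we can find a place `v₀` of `E` of degree 1 over `ℚ` such that `ρ̄(Frob_{v₀})` is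
scalar and `q_{v₀} ≢ 1 mod p`", loc. cit.; the printed `v₀ ∉ S'` and odd residue characteristic
discard finitely many further places).  Proof: `infinite_setOf_prime_absNorm_frobenius_mul_inv_mem`
for `N = ker τ ∩ ker χ̄_p` (open: `ker χ̄_p ⊇ Gal(F̄/F(ζ_p))` is open,
`modNCyclotomicCharacter_eventually_eq_one`) and `g = σ`; then `χ̄_p(Φ) = χ̄_p(σ) ≠ 1` because
`ker χ̄_p = Γ_{F(ζ_p)} ∌ σ` (`modNCyclotomicCharacter_spec`), whereas `χ̄_p(Φ) = q_v (mod p)` for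
`v ∤ p` (`modNCyclotomicCharacter_eq_residueCard_of_isArithFrobAt`).
[cite: ACCGHLNSTT2023, §6.5.12 (proof of Thm. 6.1.1, choice of `v₀`)] -/
theorem infinite_setOf_prime_absNorm_frobenius_eq_of_not_mem_adjoinRootsOfUnity
    {H : Type*} [Group H] (τ : absoluteGaloisGroup F →* H)
    (hτ : IsOpen (τ.ker : Set (absoluteGaloisGroup F))) {p : ℕ} [Fact p.Prime]
    {σ : absoluteGaloisGroup F} (hσ : σ ∉ absGaloisGroupAdjoinRootsOfUnity F p) :
    {v : HeightOneSpectrum (𝓞 F) | (Ideal.absNorm v.asIdeal).Prime ∧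
      ((p : ℕ) : 𝓞 F) ∉ v.asIdeal ∧ ¬ v.residueCard ≡ 1 [MOD p] ∧
      (∀ 𝔓 ∈ v.primesAbove, ∀ γ ∈ 𝔓.inertia (absoluteGaloisGroup F), τ γ = 1) ∧
      ∃ 𝔓 ∈ v.primesAbove, ∃ Φ : absoluteGaloisGroup F,
        IsArithFrobAt (𝓞 F) Φ 𝔓 ∧ τ Φ = τ σ}.Infinite := by
  have hp : p.Prime := Fact.out
  haveI : NeZero (p : F) := ⟨Nat.cast_ne_zero.mpr hp.ne_zero⟩
  set χ : absoluteGaloisGroup F →* (ZMod p)ˣ := modNCyclotomicCharacter F p with hχdef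
  set N : Subgroup (absoluteGaloisGroup F) := (τ.prod χ).ker with hNdef
  haveI : N.Normal := MonoidHom.normal_ker _
  have hNmem : ∀ γ : absoluteGaloisGroup F, γ ∈ N ↔ τ γ = 1 ∧ χ γ = 1 := fun γ => by
    rw [hNdef, MonoidHom.mem_ker, MonoidHom.prod_apply, Prod.mk_eq_one]
  -- `N` is open
  have hχopen : IsOpen (χ.ker : Set (absoluteGaloisGroup F)) := by
    refine Subgroup.isOpen_of_mem_nhds χ.ker (g := 1) ?_
    have h1 := modNCyclotomicCharacter_eventually_eq_one F p
    exact h1.mono fun γ hγ => (MonoidHom.mem_ker).mpr hγ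
  have hN : IsOpen (N : Set (absoluteGaloisGroup F)) := by
    have hNeq : (N : Set (absoluteGaloisGroup F)) =
        (τ.ker : Set (absoluteGaloisGroup F)) ∩ (χ.ker : Set (absoluteGaloisGroup F)) := by
      ext γ
      simp only [SetLike.mem_coe, Set.mem_inter_iff, MonoidHom.mem_ker, hNmem]
    rw [hNeq]
    exact hτ.inter hχopen
  -- `χ̄_p(σ) ≠ 1`
  have hχσ : χ σ ≠ 1 := fun h => hσ ((mem_absGaloisGroupAdjoinRootsOfUnity_iff σ).2
    fun x hx => by
      rw [modNCyclotomicCharacter_spec F p σ x hx, ← hχdef, h, Units.val_one,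
        ZMod.val_one'' hp.one_lt.ne', pow_one])
  -- discard the finitely many places above `p` (the prime factors of `(p) ≠ 0`; the same
  -- statement is `finite_setOf_natCast_mem_asIdeal` of `AdmissibleExtensionRegime.lean`, not
  -- imported here)
  have hfin : {v : HeightOneSpectrum (𝓞 F) | ((p : ℕ) : 𝓞 F) ∈ v.asIdeal}.Finite := by
    have h : Ideal.span {((p : ℕ) : 𝓞 F)} ≠ ⊥ := by
      rw [ne_eq, Ideal.span_singleton_eq_bot]
      exact_mod_cast hp.ne_zero
    refine (Ideal.finite_factors h).subset fun v hv => ?_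
    exact Ideal.dvd_iff_le.mpr ((Ideal.span_singleton_le_iff_mem _).mpr hv)
  refine (((infinite_setOf_prime_absNorm_frobenius_mul_inv_mem N hN σ).sdiff hfin).mono ?_)
  rintro v ⟨⟨hprime, hinertia, 𝔓, h𝔓, Φ, hΦ, hmem⟩, hpv⟩
  simp only [Set.mem_setOf_eq] at hpv
  obtain ⟨hτ1, hχ1⟩ := (hNmem _).mp hmem
  have hτeq : τ Φ = τ σ := mul_inv_eq_one.mp (by rwa [← map_inv, ← map_mul])
  have hχeq : χ Φ = χ σ := mul_inv_eq_one.mp (by rwa [← map_inv, ← map_mul])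
  refine ⟨hprime, hpv, fun hmod => ?_,
    fun 𝔓' h𝔓' γ hγ => ((hNmem γ).mp (hinertia 𝔓' h𝔓' hγ)).1, 𝔓, h𝔓, Φ, hΦ, hτeq⟩
  -- `χ̄_p(Φ) = q_v ≢ 1 (mod p)`
  haveI : 𝔓.IsPrime := h𝔓.1
  have hp𝔓 : ((p : ℕ) : absIntegers (𝓞 F) F) ∉ 𝔓 := by
    intro h
    apply hpv
    have h' : ((p : ℕ) : 𝓞 F) ∈ 𝔓.under (𝓞 F) := by
      rw [Ideal.under_def, Ideal.mem_comap, map_natCast]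
      exact h
    rwa [← h𝔓.2.over] at h'
  have hval := modNCyclotomicCharacter_eq_residueCard_of_isArithFrobAt (K := F) (N := p) h𝔓 hp𝔓 hΦ
  apply hχσ
  rw [← hχeq]
  ext
  rw [hχdef, hval, Units.val_one]
  have h1 := (ZMod.natCast_eq_natCast_iff _ _ _).mpr hmod
  rwa [Nat.cast_one] at h1

end Coset

end Literature.NumberTheory.GaloisRepresentations

end
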